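import Summits.Parity.BatemanHorn.Theorems.NormalFamilyBound.Negative.RealAxis

/-!
# Crux `NormalFamilyBound` (stmt-Parity-9769), line `parity-halves`: the skeleton

Route `SelbergDelangeRigidity`, crux decl `Summit.Parity.BatemanHorn.Theses.SelbergDelangeRigidity.NormalFamilyBound`:
for every Bateman–Horn system `f` the family `H_x(z) = x⁻¹ (log x)^{k(1−z)} S_x(z)`, `S_x(z) = Σ_{n ≤ x} z^{Ω_f(n)}`,
is locally bounded on a thin rectangle `V_η = {−η < Re z < 7/4, |Im z| < η}`.

Strategist line (crux-strategist wall-breaker pass, 2026-08-17; card `Lines/parity-halves.md`, census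
`STRATEGY-CENSUS.md`). This line is the DECOMPOSITION VEHICLE of the crux: it cuts the crux, with no loss
(`NormalFamilyBound ⟺ PositiveRealPartBound ∧ SmallCircleBound`, proved in `Cruxes/NormalFamilyBound/Split.lean`),
into FOUR registered stubs of three different technique classes —

* `stub_realAxisOrderSubcritical` (KNOWN, provable now in the tree, L): the positive-weight real-axis order of
  magnitude `S_x(r) ≤ C x (log x)^{k(r−1)}` for tilts `0 < r ≤ 1` (weights `r^Ω ≤ 1`: upper-bound sieve / Nair–Tenenbaum);
* `stub_realAxisOrderSupercritical` (KNOWN IN PRINT modulo a Diophantine input, XL): the same for `1 < r ≤ 15/8`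
  (Nair–Tenenbaum / Henriot after the small-prime reduction; for a non-linear member with a `ℤ_p`-root at a prime
  `p < r^{deg}` the beyond-level prime powers need Ridout's `v_p(f_i(n)) ≤ (1+ε) log_p n`, TRIAGE-r2-2 P7);
* `stub_phaseSaving` (OPEN, parity-free; the R+ content): to the right of the imaginary axis the phases
  `e^{iθ Ω_f(n)}` save `(log x)^{k(|z|−Re z)}` over the positive sum at radius `|z|` — the complex
  Landau–Selberg–Delange saving along `f` in RATIO form (a fixed-frequency large-deviation estimate for the tilted
  law of `Ω_f`), uniform down to `Re z → 0⁺`;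
* `stub_smallCircleBound` (OPEN, the parity atom): ONE small circle `‖z‖ = ρ(f)` on which `‖H_x‖` is bounded
  (at `z = −ρ`: damped Liouville along `F = ∏ f_i` with saving `(log x)^{2kρ}`; necessary by p90430 / Split.lean).

`NormalFamilyBound_of_stubs` composes them SORRY-FREE: the two real-axis stubs and the phase saving give ONE bound on
`{0 < Re z ≤ R', |Im z| < η}` for every `R' < 7/4` (`x ≤ 2` by hand), the circle gives the near-zero box
`{−η < Re z ≤ 0}` by the MAXIMUM MODULUS PRINCIPLE (`H_x` is entire), and `η := min(η₁, ρ/2, 1/4)` packages the ball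
form; `NormalFamilyBound_of` concludes the route decl BY NAME.

Vocabulary: `V`, `Ωf`, `H`, `locallyBoundedSystems` of `Theorems/NormalFamilyBound/Negative/RealAxis.lean` (landed).
The small-`x` lemmas `abs_loglog_le_one_of_le_two`, `norm_H_le_of_le_two`, `norm_lt_of_mem_V` are taken over verbatim
from the dead line's skeleton `Lines/Sketch.lean` (lead prover-line-stmt-Parity-9769-0).
-/

namespace Summit.Parity.BatemanHorn.Cruxes.NormalFamilyBound.ParityHalves

open Literature.NumberTheory.Sieve Polynomial Finset Filter
open Summit.Parity.BatemanHorn.Theses.SelbergDelangeRigidity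
open Summit.Parity.BatemanHorn.Theorems.NormalFamilyBound.Negative

noncomputable section

/-! ## The stubs -/

/-- STUB 1 (known; provable now in the tree): the positive-weight real-axis ORDER OF MAGNITUDE along a Bateman–Horn
system for SUBCRITICAL tilts `0 < r ≤ 1` (weights `r^{Ω_f(n)} ≤ 1`): `S_x(r) = Σ_{n ≤ x} r^{Ω_f(n)} ≤ C x (log x)^{k(r−1)}`
for `x ≥ 3`, uniformly in `r`. Upper-bound sieve of dimension `k(1−r)` (marking identity `r^{ω} = E[1_{sifted}]`,
Selberg Λ² for an arbitrary sifting set, Rankin, Mertens along `f`), or Nair–Tenenbaum 1998 Thm 1 / Henriot 2012 Thm 3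
directly. -/
theorem stub_realAxisOrderSubcritical :
    ∀ (k : ℕ) (f : Fin k → ℤ[X]), IsBatemanHornSystem f → ∃ C : ℝ, ∀ x : ℕ, 3 ≤ x →
      ∀ r : ℝ, 0 < r → r ≤ 1 →
        ∑ n ∈ Finset.range (x + 1), r ^ Ωf f n ≤ C * x * Real.log x ^ ((k : ℝ) * (r - 1)) := by
  sorry

/-- STUB 2 (known in print modulo Ridout; XL): the positive-weight real-axis ORDER OF MAGNITUDE for SUPERCRITICAL
tilts `1 < r ≤ 15/8`: `S_x(r) ≤ C x (log x)^{k(r−1)}` for `x ≥ 3`. Nair–Tenenbaum 1998 Thm 1 / Henriot 2012 Thm 3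
after the small-prime reduction (`Ω = Ω_{<P₀} + Ω_{≥P₀}`, `P₀ = r^{1/ε}`); prime powers `p^v ≤ x` by Type-I counts
(weights `(r/p)^v` summable, `r < 2 ≤ p`); prime powers `p^v > x` at a prime `p < r^{deg f_i}` carrying a `ℤ_p`-root
of a non-linear member need `v_p(f_i(n)) ≤ (1+ε) log_p n` for large `n` (Ridout 1958, ineffective) — TRIAGE-r2-2 P7.
Together with STUB 1 this is the dead line's registered `stub_realAxisOrder` (`0 < r ≤ 15/8`). -/
theorem stub_realAxisOrderSupercritical :
    ∀ (k : ℕ) (f : Fin k → ℤ[X]), IsBatemanHornSystem f → ∃ C : ℝ, ∀ x : ℕ, 3 ≤ x →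
      ∀ r : ℝ, 1 < r → r ≤ 15 / 8 →
        ∑ n ∈ Finset.range (x + 1), r ^ Ωf f n ≤ C * x * Real.log x ^ ((k : ℝ) * (r - 1)) := by
  sorry

/-- STUB 3 (OPEN, parity-free — the content of the crux on `Re z > 0`): the OFF-AXIS PHASE SAVING in ratio form.
For some `η > 0` and every `R' < 7/4` there is `C` with
`‖S_x(z)‖ ≤ C (log x)^{−k(|z|−Re z)} S_x(|z|)` for all `x ≥ 3` and all `z` with `0 < Re z ≤ R'`, `|Im z| < η`:
the phases `e^{iθΩ_f(n)}` (`z = |z|e^{iθ}`) cancel the positive sum at radius `|z|` down by exactly the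
Landau–Selberg–Delange factor. For `f = (X)` it is MV Thm 7.18 (proved in the tree) with the positive lower order;
for a non-linear member or `k ≥ 2` it is the fixed-frequency large-deviation estimate for the `|z|`-tilted law of
`Ω_f` along `f` (wall N6: the tilted law of the rough cofactor of `F(n)` beyond level `x`). Equivalent near each arc
to the dead line's `stub_phaseVelocityLB` (p87623 + Cauchy); `1 ± λ(F(n))` reweightings move it by `O(1)`. -/
theorem stub_phaseSaving :
    ∀ (k : ℕ) (f : Fin k → ℤ[X]), IsBatemanHornSystem f → ∃ η : ℝ, 0 < η ∧ ∀ R' : ℝ, R' < 7 / 4 →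
      ∃ C : ℝ, ∀ x : ℕ, 3 ≤ x → ∀ z : ℂ, 0 < z.re → z.re ≤ R' → |z.im| < η →
        ‖∑ n ∈ Finset.range (x + 1), z ^ Ωf f n‖ ≤
          C * Real.log x ^ (-((k : ℝ) * (‖z‖ - z.re))) * ∑ n ∈ Finset.range (x + 1), ‖z‖ ^ Ωf f n := by
  sorry

/-- STUB 4 (OPEN, the parity atom — the content of the crux on `Re z ≤ 0`): ONE SMALL CIRCLE. For some `ρ > 0` and
`M`, `‖H_x(z)‖ ≤ M` for all `x` and all `z` with `‖z‖ = ρ` (stated verbatim over Mathlib, as the route's sub-crux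
`SmallCircleBound`). At `z = −ρ`: `|Σ_j π_j(x)(−ρ)^j| ≤ M x (log x)^{−k(1+ρ)}`, damped Liouville/Chowla along
`F = ∏ f_i` with saving `(log x)^{2kρ}` (= `RealSegmentParity`, necessary by p90430); at `ρe^{iθ}` the cost is
`(log x)^{kρ(1−cos θ)}`. Holds for `f = (X)` (MV Thm 7.18, proved); open for every non-linear member or `k ≥ 2`. -/
theorem stub_smallCircleBound :
    ∀ (k : ℕ) (f : Fin k → Polynomial ℤ), Literature.NumberTheory.Sieve.IsBatemanHornSystem f →
      ∃ ρ : ℝ, 0 < ρ ∧ ∃ M : ℝ, ∀ x : ℕ, ∀ z : ℂ, ‖z‖ = ρ →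
        ‖(x : ℂ)⁻¹ * Complex.exp ((k : ℂ) * (1 - z) * (Real.log (Real.log x) : ℂ)) *
            ∑ n ∈ Finset.range (x + 1), z ^ (∑ i, ArithmeticFunction.cardFactors (((f i).eval (n : ℤ)).toNat))‖
          ≤ M := by
  sorry

/-! ## Bookkeeping lemmas (sorry-free) -/

/-- `|log log x| ≤ 1` for the finitely many `x ≤ 2`. (From `Lines/Sketch.lean`.) -/
theorem abs_loglog_le_one_of_le_two {x : ℕ} (hx : x ≤ 2) : |Real.log (Real.log (x : ℝ))| ≤ 1 := by
  interval_cases x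
  · simp
  · simp
  · rw [show ((2 : ℕ) : ℝ) = 2 by norm_num]
    have hl0 : (1 : ℝ) / 2 < Real.log 2 := by have := Real.log_two_gt_d9; linarith
    have hl1 : Real.log 2 ≤ 1 := by
      have := Real.log_le_sub_one_of_pos (by norm_num : (0 : ℝ) < 2); linarith
    have hup : Real.log (Real.log 2) ≤ 0 := Real.log_nonpos (by linarith) hl1
    have hdown : -1 ≤ Real.log (Real.log 2) := by
      have h := Real.log_le_log (by norm_num : (0:ℝ) < 1 / 2) hl0.le
      have e : Real.log (1 / 2 : ℝ) = -Real.log 2 := by rw [one_div, Real.log_inv]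
      rw [e] at h
      linarith
    exact abs_le.mpr ⟨hdown, by linarith⟩

/-- The finitely many `x ≤ 2`: `‖H_x(z)‖ ≤ e^{3k} Σ_{n<3} 2^{Ω_f(n)}` on `‖z‖ ≤ 2`. (From `Lines/Sketch.lean`.) -/
theorem norm_H_le_of_le_two (k : ℕ) (f : Fin k → ℤ[X]) {x : ℕ} (hx : x ≤ 2) {z : ℂ} (hz : ‖z‖ ≤ 2) :
    ‖H k f x z‖ ≤ Real.exp (3 * k) * ∑ n ∈ Finset.range 3, (2 : ℝ) ^ Ωf f n := by
  have hsum_nonneg : 0 ≤ ∑ n ∈ Finset.range 3, (2 : ℝ) ^ Ωf f n :=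
    Finset.sum_nonneg fun n _ => by positivity
  have hinv : ‖((x : ℂ))⁻¹‖ ≤ 1 := by
    rw [norm_inv, Complex.norm_natCast]
    rcases Nat.eq_zero_or_pos x with rfl | hx0
    · simp
    · have : (1 : ℝ) ≤ x := by exact_mod_cast hx0
      exact inv_le_one_of_one_le₀ this
  have hN : ‖Complex.exp ((k : ℂ) * (1 - z) * (Real.log (Real.log (x : ℝ)) : ℂ))‖ ≤ Real.exp (3 * k) := by
    rw [Complex.norm_exp]
    apply Real.exp_le_exp.mpr
    have h1 : ((k : ℂ) * (1 - z) * (Real.log (Real.log (x : ℝ)) : ℂ)).re ≤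
        ‖(k : ℂ) * (1 - z) * (Real.log (Real.log (x : ℝ)) : ℂ)‖ := Complex.re_le_norm _
    refine h1.trans ?_
    rw [norm_mul, norm_mul, Complex.norm_natCast, Complex.norm_real, Real.norm_eq_abs]
    have h1z : ‖(1 : ℂ) - z‖ ≤ 3 := by
      calc ‖(1 : ℂ) - z‖ ≤ ‖(1 : ℂ)‖ + ‖z‖ := norm_sub_le _ _
        _ ≤ 1 + 2 := by rw [norm_one]; linarith
        _ = 3 := by norm_num
    have hL := abs_loglog_le_one_of_le_two hx
    have hk : (0 : ℝ) ≤ k := Nat.cast_nonneg k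
    calc (k : ℝ) * ‖(1 : ℂ) - z‖ * |Real.log (Real.log (x : ℝ))| ≤ (k : ℝ) * 3 * 1 := by
          gcongr
      _ = 3 * k := by ring
  have hS : ‖∑ n ∈ Finset.range (x + 1),
      z ^ (∑ i, ArithmeticFunction.cardFactors (((f i).eval (n : ℤ)).toNat))‖ ≤
      ∑ n ∈ Finset.range 3, (2 : ℝ) ^ Ωf f n := by
    calc ‖∑ n ∈ Finset.range (x + 1), z ^ (∑ i, ArithmeticFunction.cardFactors (((f i).eval (n : ℤ)).toNat))‖
        ≤ ∑ n ∈ Finset.range (x + 1), ‖z ^ (∑ i, ArithmeticFunction.cardFactors (((f i).eval (n : ℤ)).toNat))‖ :=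
          norm_sum_le _ _
      _ = ∑ n ∈ Finset.range (x + 1), ‖z‖ ^ Ωf f n := by
          refine Finset.sum_congr rfl fun n _ => ?_
          rw [norm_pow]; rfl
      _ ≤ ∑ n ∈ Finset.range (x + 1), (2 : ℝ) ^ Ωf f n :=
          Finset.sum_le_sum fun n _ => pow_le_pow_left₀ (norm_nonneg _) hz _
      _ ≤ ∑ n ∈ Finset.range 3, (2 : ℝ) ^ Ωf f n := by
          apply Finset.sum_le_sum_of_subset_of_nonneg
          · exact Finset.range_mono (by omega)
          · intro n _ _; positivity
  calc ‖H k f x z‖ = ‖((x : ℂ))⁻¹‖ * ‖Complex.exp ((k : ℂ) * (1 - z) * (Real.log (Real.log (x : ℝ)) : ℂ))‖ *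
        ‖∑ n ∈ Finset.range (x + 1), z ^ (∑ i, ArithmeticFunction.cardFactors (((f i).eval (n : ℤ)).toNat))‖ := by
        rw [H, norm_mul, norm_mul]
    _ ≤ 1 * Real.exp (3 * k) * ∑ n ∈ Finset.range 3, (2 : ℝ) ^ Ωf f n := by
        gcongr
    _ = Real.exp (3 * k) * ∑ n ∈ Finset.range 3, (2 : ℝ) ^ Ωf f n := by ring

/-- Points of the thin rectangle have modulus `< 15/8`. (From `Lines/Sketch.lean`.) -/
theorem norm_lt_of_mem_V {η : ℝ} (hη : η ≤ 1 / 4) {z : ℂ} (hz : z ∈ V (7 / 4) η) : ‖z‖ < 15 / 8 := by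
  obtain ⟨h1, h2, h3⟩ := hz
  have him := abs_lt.mp h3
  have hsq : ‖z‖ ^ 2 < (15 / 8) ^ 2 := by
    rw [Complex.sq_norm, Complex.normSq_apply]
    nlinarith [him.1, him.2]
  exact lt_of_pow_lt_pow_left₀ 2 (by norm_num) hsq

/-- The norm of `H_x(z)` factorises: `‖H_x(z)‖ = x⁻¹ · e^{k(1 − Re z) log log x} · ‖S_x(z)‖`. -/
theorem norm_H_eq (k : ℕ) (f : Fin k → ℤ[X]) (x : ℕ) (z : ℂ) :
    ‖H k f x z‖ = (x : ℝ)⁻¹ * Real.exp ((k : ℝ) * (1 - z.re) * Real.log (Real.log x)) *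
      ‖∑ n ∈ Finset.range (x + 1), z ^ Ωf f n‖ := by
  rw [H, norm_mul, norm_mul, norm_inv, Complex.norm_natCast, Complex.norm_exp]
  congr 3
  simp only [Complex.mul_re, Complex.mul_im, Complex.sub_re, Complex.sub_im, Complex.one_re,
    Complex.one_im, Complex.ofReal_re, Complex.ofReal_im, Complex.natCast_re, Complex.natCast_im]
  ring

/-- Each `H_x` is an entire function of `z`. -/
theorem differentiable_H (k : ℕ) (f : Fin k → ℤ[X]) (x : ℕ) : Differentiable ℂ (H k f x) := by
  have h1 : Differentiable ℂ
      (fun z : ℂ => (x : ℂ)⁻¹ * Complex.exp ((k : ℂ) * (1 - z) * (Real.log (Real.log x) : ℂ))) :=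
    (differentiable_const _).mul
      ((((differentiable_const _).mul ((differentiable_const _).sub differentiable_id)).mul
        (differentiable_const _)).cexp)
  have h2 : Differentiable ℂ (fun z : ℂ =>
      ∑ n ∈ Finset.range (x + 1), z ^ (∑ i, ArithmeticFunction.cardFactors (((f i).eval (n : ℤ)).toNat))) :=
    Differentiable.fun_sum fun n _ => differentiable_id.pow _
  exact h1.mul h2

/-- MAXIMUM MODULUS for the family: a bound on the circle `‖w‖ = ρ` holds on the closed disc `‖z‖ ≤ ρ`. -/
theorem norm_H_le_of_sphere {k : ℕ} (f : Fin k → ℤ[X]) (x : ℕ) {ρ M : ℝ} (hρ : 0 < ρ)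
    (hM : ∀ w : ℂ, ‖w‖ = ρ → ‖H k f x w‖ ≤ M) {z : ℂ} (hz : ‖z‖ ≤ ρ) : ‖H k f x z‖ ≤ M := by
  have hdc : DiffContOnCl ℂ (H k f x) (Metric.ball (0 : ℂ) ρ) := (differentiable_H k f x).diffContOnCl
  refine Complex.norm_le_of_forall_mem_frontier_norm_le Metric.isBounded_ball hdc (fun w hw => ?_) ?_
  · rw [frontier_ball (0 : ℂ) hρ.ne', mem_sphere_zero_iff_norm] at hw
    exact hM w hw
  · rw [closure_ball (0 : ℂ) hρ.ne']
    exact Metric.mem_closedBall.mpr (by simpa using hz)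

/-! ## The composition (sorry-free) -/

/-- THE R+ HALF FROM STUBS 1–3: the two real-axis orders and the phase saving give, for every `R' < 7/4`, ONE bound
`‖H_x(z)‖ ≤ M` on `{0 < Re z ≤ R', |Im z| < η}` for ALL `x` (`x ≤ 2` by `norm_H_le_of_le_two`). On `x ≥ 3`:
`‖H_x(z)‖ = x⁻¹ (log x)^{k(1−Re z)} ‖S_x(z)‖ ≤ x⁻¹ (log x)^{k(1−Re z)} · C (log x)^{−k(|z|−Re z)} S_x(|z|)
≤ C · C_A`, since `S_x(|z|) ≤ C_A x (log x)^{k(|z|−1)}` with `0 < |z| ≤ 15/8`. This is the statement of the route's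
sub-crux `PositiveRealPartBound` (vocabulary `H`). -/
theorem positiveRealPart_of_stubs
    (hA1 : ∀ (k : ℕ) (f : Fin k → ℤ[X]), IsBatemanHornSystem f → ∃ C : ℝ, ∀ x : ℕ, 3 ≤ x →
      ∀ r : ℝ, 0 < r → r ≤ 1 →
        ∑ n ∈ Finset.range (x + 1), r ^ Ωf f n ≤ C * x * Real.log x ^ ((k : ℝ) * (r - 1)))
    (hA2 : ∀ (k : ℕ) (f : Fin k → ℤ[X]), IsBatemanHornSystem f → ∃ C : ℝ, ∀ x : ℕ, 3 ≤ x →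
      ∀ r : ℝ, 1 < r → r ≤ 15 / 8 →
        ∑ n ∈ Finset.range (x + 1), r ^ Ωf f n ≤ C * x * Real.log x ^ ((k : ℝ) * (r - 1)))
    (hP : ∀ (k : ℕ) (f : Fin k → ℤ[X]), IsBatemanHornSystem f → ∃ η : ℝ, 0 < η ∧ ∀ R' : ℝ, R' < 7 / 4 →
      ∃ C : ℝ, ∀ x : ℕ, 3 ≤ x → ∀ z : ℂ, 0 < z.re → z.re ≤ R' → |z.im| < η →
        ‖∑ n ∈ Finset.range (x + 1), z ^ Ωf f n‖ ≤
          C * Real.log x ^ (-((k : ℝ) * (‖z‖ - z.re))) * ∑ n ∈ Finset.range (x + 1), ‖z‖ ^ Ωf f n)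
    {k : ℕ} {f : Fin k → ℤ[X]} (hf : IsBatemanHornSystem f) :
    ∃ η : ℝ, 0 < η ∧ ∀ R' : ℝ, R' < 7 / 4 → ∃ M : ℝ, ∀ x : ℕ, ∀ z : ℂ,
      0 < z.re → z.re ≤ R' → |z.im| < η → ‖H k f x z‖ ≤ M := by
  obtain ⟨C₁, hC₁⟩ := hA1 k f hf
  obtain ⟨C₂, hC₂⟩ := hA2 k f hf
  obtain ⟨η₁, hη₁, hR⟩ := hP k f hf
  -- one real-axis constant for the whole range `0 < r ≤ 15/8`
  set CA : ℝ := max (max C₁ C₂) 0 with hCAdef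
  have hCA0 : 0 ≤ CA := le_max_right _ _
  have hA : ∀ x : ℕ, 3 ≤ x → ∀ r : ℝ, 0 < r → r ≤ 15 / 8 →
      ∑ n ∈ Finset.range (x + 1), r ^ Ωf f n ≤ CA * x * Real.log x ^ ((k : ℝ) * (r - 1)) := by
    intro x hx r hr0 hr
    have hpos : 0 ≤ (x : ℝ) * Real.log x ^ ((k : ℝ) * (r - 1)) := by positivity
    rcases le_or_gt r 1 with hr1 | hr1
    · calc ∑ n ∈ Finset.range (x + 1), r ^ Ωf f n ≤ C₁ * x * Real.log x ^ ((k : ℝ) * (r - 1)) :=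
            hC₁ x hx r hr0 hr1
        _ = C₁ * (x * Real.log x ^ ((k : ℝ) * (r - 1))) := by ring
        _ ≤ CA * (x * Real.log x ^ ((k : ℝ) * (r - 1))) := by
            gcongr; exact (le_max_left _ _).trans (le_max_left _ _)
        _ = CA * x * Real.log x ^ ((k : ℝ) * (r - 1)) := by ring
    · calc ∑ n ∈ Finset.range (x + 1), r ^ Ωf f n ≤ C₂ * x * Real.log x ^ ((k : ℝ) * (r - 1)) :=
            hC₂ x hx r hr1 hr
        _ = C₂ * (x * Real.log x ^ ((k : ℝ) * (r - 1))) := by ring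
        _ ≤ CA * (x * Real.log x ^ ((k : ℝ) * (r - 1))) := by
            gcongr; exact (le_max_right _ _).trans (le_max_left _ _)
        _ = CA * x * Real.log x ^ ((k : ℝ) * (r - 1)) := by ring
  refine ⟨min η₁ (1 / 4), lt_min hη₁ (by norm_num), fun R' hR' => ?_⟩
  obtain ⟨C, hC⟩ := hR R' hR'
  set C' : ℝ := max C 0 with hC'def
  have hC'0 : 0 ≤ C' := le_max_right _ _
  set E : ℝ := Real.exp (3 * k) * ∑ n ∈ Finset.range 3, (2 : ℝ) ^ Ωf f n with hEdef
  refine ⟨max (C' * CA) E, fun x z hre hreR him => ?_⟩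
  have him4 : |z.im| < 1 / 4 := lt_of_lt_of_le him (min_le_right _ _)
  have himη : |z.im| < η₁ := lt_of_lt_of_le him (min_le_left _ _)
  -- the modulus of `z`
  have hzV : z ∈ V (7 / 4) (1 / 4) := ⟨by linarith, by linarith, him4⟩
  have hzlt : ‖z‖ < 15 / 8 := norm_lt_of_mem_V le_rfl hzV
  have hz0 : 0 < ‖z‖ := lt_of_lt_of_le hre ((le_abs_self _).trans (Complex.abs_re_le_norm z))
  by_cases hx : 3 ≤ x
  · -- `x ≥ 3`: the exponents cancel
    have hx0 : (0 : ℝ) < x := by exact_mod_cast (show 0 < x by omega)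
    have hx1 : (1 : ℝ) < x := by exact_mod_cast (show 1 < x by omega)
    have hlog : 0 < Real.log x := Real.log_pos hx1
    set L : ℝ := Real.log (Real.log x) with hL
    set r : ℝ := ‖z‖ with hrdef
    set Sz : ℝ := ‖∑ n ∈ Finset.range (x + 1), z ^ Ωf f n‖ with hSz
    set Sr : ℝ := ∑ n ∈ Finset.range (x + 1), r ^ Ωf f n with hSr
    have hSr0 : 0 ≤ Sr := Finset.sum_nonneg fun n _ => by positivity
    -- the two inputs, in exponential form
    have hPz : Sz ≤ C' * Real.exp (-((k : ℝ) * (r - z.re)) * L) * Sr := by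
      have h1 := hC x hx z hre hreR himη
      have hrp : Real.log x ^ (-((k : ℝ) * (‖z‖ - z.re))) = Real.exp (-((k : ℝ) * (r - z.re)) * L) := by
        rw [Real.rpow_def_of_pos hlog, hL, hrdef, mul_comm]
      rw [hrp] at h1
      have hE0 : 0 ≤ Real.exp (-((k : ℝ) * (r - z.re)) * L) * Sr := by positivity
      calc Sz ≤ C * Real.exp (-((k : ℝ) * (r - z.re)) * L) * Sr := h1
        _ = C * (Real.exp (-((k : ℝ) * (r - z.re)) * L) * Sr) := by ring
        _ ≤ C' * (Real.exp (-((k : ℝ) * (r - z.re)) * L) * Sr) := by gcongr; exact le_max_left _ _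
        _ = C' * Real.exp (-((k : ℝ) * (r - z.re)) * L) * Sr := by ring
    have hAr : Sr ≤ CA * x * Real.exp ((k : ℝ) * (r - 1) * L) := by
      have h1 := hA x hx r hz0 hzlt.le
      have hrp : Real.log x ^ ((k : ℝ) * (r - 1)) = Real.exp ((k : ℝ) * (r - 1) * L) := by
        rw [Real.rpow_def_of_pos hlog, hL, mul_comm]
      rw [hrp] at h1
      exact h1
    have hnorm : ‖H k f x z‖ = (x : ℝ)⁻¹ * Real.exp ((k : ℝ) * (1 - z.re) * L) * Sz := by
      rw [norm_H_eq, hL, hSz]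
    have hxne : (x : ℝ) ≠ 0 := hx0.ne'
    calc ‖H k f x z‖ = (x : ℝ)⁻¹ * Real.exp ((k : ℝ) * (1 - z.re) * L) * Sz := hnorm
      _ ≤ (x : ℝ)⁻¹ * Real.exp ((k : ℝ) * (1 - z.re) * L) *
            (C' * Real.exp (-((k : ℝ) * (r - z.re)) * L) * (CA * x * Real.exp ((k : ℝ) * (r - 1) * L))) := by
          gcongr
          calc Sz ≤ C' * Real.exp (-((k : ℝ) * (r - z.re)) * L) * Sr := hPz
            _ ≤ C' * Real.exp (-((k : ℝ) * (r - z.re)) * L) * (CA * x * Real.exp ((k : ℝ) * (r - 1) * L)) := by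
                gcongr
      _ = C' * CA * ((x : ℝ)⁻¹ * x) *
            Real.exp ((k : ℝ) * (1 - z.re) * L + -((k : ℝ) * (r - z.re)) * L + (k : ℝ) * (r - 1) * L) := by
          rw [Real.exp_add, Real.exp_add]; ring
      _ = C' * CA := by
          rw [inv_mul_cancel₀ hxne]
          have : (k : ℝ) * (1 - z.re) * L + -((k : ℝ) * (r - z.re)) * L + (k : ℝ) * (r - 1) * L = 0 := by ring
          rw [this, Real.exp_zero]; ring
      _ ≤ max (C' * CA) E := le_max_left _ _
  · -- `x ≤ 2`
    push Not at hx
    have hz2 : ‖z‖ ≤ 2 := by linarith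
    exact (norm_H_le_of_le_two k f (by omega) hz2).trans (le_max_right _ _)

/-- **Composition (sorry-free): the four stub STATEMENTS imply the crux statement** (in the vocabulary
`locallyBoundedSystems` of Negative/RealAxis; `normalFamilyBound_iff` is `Iff.rfl`). R+ from
`positiveRealPart_of_stubs`; the near-zero box from the circle by the maximum modulus principle; packaging with
`η := min(η₁, ρ/2, 1/4)`: a point `a ∈ V_η` gets the ball of radius `R' − Re a`, `R' := (Re a + 7/4)/2 < 7/4`; on it
the points with `Re z > 0` have `Re z ≤ R'`, and the points with `Re z ≤ 0` have `‖z‖ ≤ |Re z| + |Im z| < 2η ≤ ρ`. -/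
theorem NormalFamilyBound_of_stubs
    (hA1 : ∀ (k : ℕ) (f : Fin k → ℤ[X]), IsBatemanHornSystem f → ∃ C : ℝ, ∀ x : ℕ, 3 ≤ x →
      ∀ r : ℝ, 0 < r → r ≤ 1 →
        ∑ n ∈ Finset.range (x + 1), r ^ Ωf f n ≤ C * x * Real.log x ^ ((k : ℝ) * (r - 1)))
    (hA2 : ∀ (k : ℕ) (f : Fin k → ℤ[X]), IsBatemanHornSystem f → ∃ C : ℝ, ∀ x : ℕ, 3 ≤ x →
      ∀ r : ℝ, 1 < r → r ≤ 15 / 8 →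
        ∑ n ∈ Finset.range (x + 1), r ^ Ωf f n ≤ C * x * Real.log x ^ ((k : ℝ) * (r - 1)))
    (hP : ∀ (k : ℕ) (f : Fin k → ℤ[X]), IsBatemanHornSystem f → ∃ η : ℝ, 0 < η ∧ ∀ R' : ℝ, R' < 7 / 4 →
      ∃ C : ℝ, ∀ x : ℕ, 3 ≤ x → ∀ z : ℂ, 0 < z.re → z.re ≤ R' → |z.im| < η →
        ‖∑ n ∈ Finset.range (x + 1), z ^ Ωf f n‖ ≤
          C * Real.log x ^ (-((k : ℝ) * (‖z‖ - z.re))) * ∑ n ∈ Finset.range (x + 1), ‖z‖ ^ Ωf f n)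
    (hC : ∀ (k : ℕ) (f : Fin k → Polynomial ℤ), Literature.NumberTheory.Sieve.IsBatemanHornSystem f →
      ∃ ρ : ℝ, 0 < ρ ∧ ∃ M : ℝ, ∀ x : ℕ, ∀ z : ℂ, ‖z‖ = ρ →
        ‖(x : ℂ)⁻¹ * Complex.exp ((k : ℂ) * (1 - z) * (Real.log (Real.log x) : ℂ)) *
            ∑ n ∈ Finset.range (x + 1), z ^ (∑ i, ArithmeticFunction.cardFactors (((f i).eval (n : ℤ)).toNat))‖
          ≤ M) :
    ∀ (k : ℕ) (f : Fin k → ℤ[X]), IsBatemanHornSystem f → f ∈ locallyBoundedSystems (7 / 4) k := by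
  intro k f hf
  obtain ⟨η₁, hη₁, hR⟩ := positiveRealPart_of_stubs hA1 hA2 hP hf
  obtain ⟨ρ, hρ, M₂, hM₂⟩ := hC k f hf
  set η : ℝ := min (min η₁ (ρ / 2)) (1 / 4) with hηdef
  have hη : 0 < η := lt_min (lt_min hη₁ (by linarith)) (by norm_num)
  have hηη₁ : η ≤ η₁ := (min_le_left _ _).trans (min_le_left _ _)
  have hηρ : η ≤ ρ / 2 := (min_le_left _ _).trans (min_le_right _ _)
  have hη4 : η ≤ 1 / 4 := min_le_right _ _
  refine ⟨η, hη, hη4, fun a ha => ?_⟩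
  obtain ⟨-, ha2, -⟩ := ha
  set R' : ℝ := (a.re + 7 / 4) / 2 with hR'def
  have hR'lt : R' < 7 / 4 := by rw [hR'def]; linarith
  have haR' : a.re < R' := by rw [hR'def]; linarith
  obtain ⟨M₁, hM₁⟩ := hR R' hR'lt
  refine ⟨max M₁ M₂, R' - a.re, by linarith, fun x z hz => ?_⟩
  obtain ⟨hzb, hz1, -, hz3⟩ := hz
  have hzre : z.re ≤ R' := by
    have hd : ‖z - a‖ < R' - a.re := by rwa [Metric.mem_ball, Complex.dist_eq] at hzb
    have h1 : |(z - a).re| ≤ ‖z - a‖ := Complex.abs_re_le_norm (z - a)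
    rw [Complex.sub_re] at h1
    have h2 := (abs_le.mp (h1.trans hd.le)).2
    linarith
  by_cases hpos : 0 < z.re
  · exact (hM₁ x z hpos hzre (lt_of_lt_of_le hz3 hηη₁)).trans (le_max_left _ _)
  · push Not at hpos
    have hnorm : ‖z‖ ≤ ρ := by
      have h := Complex.norm_le_abs_re_add_abs_im z
      have hre : |z.re| < η := by rw [abs_lt]; constructor <;> linarith
      linarith
    exact (norm_H_le_of_sphere f x hρ (fun w hw => hM₂ x w hw) hnorm).trans (le_max_right _ _)

/-- **The line concludes the crux BY NAME**: the route decl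
`Summit.Parity.BatemanHorn.Theses.SelbergDelangeRigidity.NormalFamilyBound` from the four registered stubs. -/
theorem NormalFamilyBound_of : NormalFamilyBound :=
  normalFamilyBound_iff.mpr
    (NormalFamilyBound_of_stubs stub_realAxisOrderSubcritical stub_realAxisOrderSupercritical stub_phaseSaving
      stub_smallCircleBound)

end

end Summit.Parity.BatemanHorn.Cruxes.NormalFamilyBound.ParityHalves
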